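import Summits.Schanuel.Schanuel.Theorems.RootDecomp1KKummerIndependence

/-!
# RootDecomp1KKummerCells — §22 REV D «KummerCells» port, part 4/4 (lens 6, gen 10 = ROUND 5 theorem round of route-Schanuel-RootDecomp1K on A₄ʰ stmt-Schanuel-33363)

Mechanical port (census-1 gen 8; tools tools/build_dark.py over census/tools/gen7/portkit2.py) of §22 of HOME/decomp-schanuel-lens-6/g10/addendum/KummerCells.lean
(sha256 228dad56…, 9085 l; critic VERDICT 2026-08-30T17:19:03Z ACCEPTED — THEOREM ROUND, PATH T, census C-7) on top of the §17 wave Theorems/RootDecomp1KHyper01…19.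
This part: node lines 8899–9052 (7 declarations: algebraicIndependent_kummer, HyperLiouville.ne_ratCast, HyperLiouville.ne_zero, sb_kummer_of_mem, hyperCell_ratLog2_any, hyperCell_ratLog2_pair_live …).
The node-local named fact `NWThm1` is replaced by the registered Literature fact
`Literature.NumberTheory.Transcendental.NesterenkoWaldschmidt1996_thm_1` (token-identical body); statements and proofs
are otherwise the node's verbatim, in the wave namespace `Summit.Schanuel.Schanuel.Theorems.RootDecomp1KHyper` (sub-namespace `HyperCell`).
`--supports stmt-Schanuel-33363` (A₄ʰ HyperLiouvilleSchanuel: decided n = 2, 3 cells at every Kummer anchor s·log 2, s ∈ ℚ^× (ρ hyper-Liouville), mod the registered fact NW96 Thm 1 alone). Sorry-free; standard axioms. Nothing here proves Schanuel; rung 0.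
-/

set_option linter.dupNamespace false
set_option linter.unusedSectionVars false

noncomputable section

open Complex IntermediateField Filter Polynomial
open Literature.NumberTheory.Transcendental (NesterenkoWaldschmidt1996_thm_1)

namespace Summit.Schanuel.Schanuel.Theorems.RootDecomp1KHyper

variable {n K : ℕ}

namespace HyperCell

variable {n K : ℕ}

/-- **Kummer extraction, algebraic form** (mod NW 1996 Thm 1): `ρ, log 2, 2^ρ` are algebraically
independent over `ℚ` for every hyper-Liouville real `ρ > 0`. -/
theorem algebraicIndependent_kummer (hNW : NesterenkoWaldschmidt1996_thm_1) {ρ : ℝ} (hρ : HyperLiouville ρ) (hρ0 : 0 < ρ) :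
    AlgebraicIndependent ℚ
      ![(ρ : ℂ), ((Real.log 2 : ℝ) : ℂ), cexp (((Real.log 2 : ℝ) : ℂ) * (ρ : ℂ))] :=
  algebraicIndependent_of_forall_int fun G hG => kummer_aeval_ne_zero' hNW hρ hρ0 G hG

/-- No rational number — in particular not `0` — is hyper-Liouville. -/
theorem HyperLiouville.ne_ratCast {ρ : ℝ} (hρ : HyperLiouville ρ) (t : ℚ) : ρ ≠ t := by
  intro h0
  obtain ⟨r, hden, hr, hη⟩ := hρ (t.den + 1)
  rw [h0] at hη hr
  have hrt : t - r ≠ 0 := fun h => hr (by rw [sub_eq_zero.mp h])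
  have hq : (0 : ℝ) < (t - r).den := by exact_mod_cast (t - r).den_pos
  have h1 : (1 : ℝ) / (t - r).den ≤ |((t : ℝ) - r)| := by
    have e : ((t : ℝ) - r) = (((t - r : ℚ).num : ℝ)) / ((t - r).den : ℝ) := by
      rw [← Rat.cast_sub]; exact_mod_cast (Rat.num_div_den (t - r)).symm
    rw [e, abs_div, Nat.abs_cast, div_le_div_iff_of_pos_right hq]
    exact_mod_cast Int.one_le_abs (Rat.num_ne_zero.mpr hrt)
  have hdd : ((t - r).den : ℝ) ≤ (t.den : ℝ) * r.den := by
    have := Rat.sub_den_dvd t r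
    exact_mod_cast Nat.le_of_dvd (Nat.mul_pos t.den_pos r.den_pos) this
  have hrden : (1 : ℝ) ≤ r.den := by exact_mod_cast r.den_pos
  have htden : (1 : ℝ) ≤ t.den := by exact_mod_cast t.den_pos
  have hm : ((t.den : ℝ) + 1) ≤ r.den := by exact_mod_cast hden
  have h2 : Real.exp (-((r.den : ℝ) ^ (t.den + 1))) < 1 / ((t.den : ℝ) * r.den) := by
    have hpos : (0 : ℝ) < (t.den : ℝ) * r.den := by positivity
    rw [Real.exp_neg, lt_div_iff₀ hpos]
    have hX : (t.den : ℝ) * r.den ≤ (r.den : ℝ) ^ (t.den + 1) := by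
      rw [pow_succ]
      have : (t.den : ℝ) ≤ (r.den : ℝ) ^ t.den := by
        calc (t.den : ℝ) ≤ r.den := by linarith
          _ = (r.den : ℝ) ^ 1 := (pow_one _).symm
          _ ≤ (r.den : ℝ) ^ t.den := pow_le_pow_right₀ hrden t.den_pos
      exact mul_le_mul this le_rfl (by positivity) (by positivity)
    have hlt : (r.den : ℝ) ^ (t.den + 1) < Real.exp ((r.den : ℝ) ^ (t.den + 1)) := by
      linarith [Real.add_one_le_exp ((r.den : ℝ) ^ (t.den + 1))]
    have h3 : (t.den : ℝ) * r.den < Real.exp ((r.den : ℝ) ^ (t.den + 1)) := lt_of_le_of_lt hX hlt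
    have := mul_lt_mul_of_pos_left h3 (inv_pos.mpr (Real.exp_pos ((r.den : ℝ) ^ (t.den + 1))))
    rwa [inv_mul_cancel₀ (Real.exp_pos _).ne'] at this
  have h3 : (1 : ℝ) / ((t.den : ℝ) * r.den) ≤ 1 / (t - r).den :=
    one_div_le_one_div_of_le hq hdd
  linarith

/-- §22l. The KUMMER CELLS of A₄ʰ: anchors s·log 2, s ∈ ℚ^× (mod NW 1996 Theorem 1): auxiliary statement `HyperLiouville.ne_zero` (lens 6 gen 10 node, ported verbatim). -/
theorem HyperLiouville.ne_zero {ρ : ℝ} (hρ : HyperLiouville ρ) : ρ ≠ 0 := by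
  have := hρ.ne_ratCast 0; rwa [Rat.cast_zero] at this

/-- `SB N z` (`N ≤ 3`) as soon as `ℚ(z, e^z, i)` contains `ρ', log 2, 2^{ρ'}` for a hyper-Liouville
`ρ' > 0` (mod NW 1996 Thm 1). -/
theorem sb_kummer_of_mem (hNW : NesterenkoWaldschmidt1996_thm_1) {ρ' : ℝ} (hρ' : HyperLiouville ρ') (hρ'0 : 0 < ρ')
    {N : ℕ} (hN : N ≤ 3) {z : Fin N → ℂ} (h0 : (ρ' : ℂ) ∈ adjoin ℚ (SFset z ∪ {I}))
    (h1 : ((Real.log 2 : ℝ) : ℂ) ∈ adjoin ℚ (SFset z ∪ {I}))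
    (h2 : cexp (((Real.log 2 : ℝ) : ℂ) * (ρ' : ℂ)) ∈ adjoin ℚ (SFset z ∪ {I})) : SB N z := by
  refine sb_of_algebraicIndependent (algebraicIndependent_kummer hNW hρ' hρ'0) (by simpa using hN)
    fun j => ?_
  fin_cases j
  · exact h0
  · exact h1
  · exact h2

/-- **KUMMER CELLS at every anchor `t = s·log 2`, `s ∈ ℚ^×` (kernel, mod the REGISTERED fact
NW 1996 Theorem 1).**  For a hyper-Liouville `ρ` and ANY `w`: the pair `(t, ρt)` and the triple
`(t, ρt, w)` are `HyperLinLiouville` and satisfy `SB 2`, `SB 3` — via the Kummer triple of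
`ρ' = ±s·ρ > 0` (hyper-Liouville by `rat_mul`): `ℚ(z, e^z, i) ∋ log 2 = z₀/s, ρ' = ±s·z₁/z₀,
2^{ρ'} = (e^{z₁})^{±1}`.  These anchors are REAL LOGARITHMS OF RATIONALS: no torsion, no `π`, no LW
storey, no measured classical 2-system. -/
theorem hyperCell_ratLog2_any (hNW : NesterenkoWaldschmidt1996_thm_1) {ρ : ℝ} (hρ : HyperLiouville ρ) {s : ℚ} (hs : s ≠ 0)
    (w : ℂ) :
    HyperLinLiouville ![(s : ℂ) * ((Real.log 2 : ℝ) : ℂ), (ρ : ℂ) * ((s : ℂ) * ((Real.log 2 : ℝ) : ℂ)), w] ∧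
      SB 2 ![(s : ℂ) * ((Real.log 2 : ℝ) : ℂ), (ρ : ℂ) * ((s : ℂ) * ((Real.log 2 : ℝ) : ℂ))] ∧
      SB 3 ![(s : ℂ) * ((Real.log 2 : ℝ) : ℂ), (ρ : ℂ) * ((s : ℂ) * ((Real.log 2 : ℝ) : ℂ)), w] := by
  have hl0 : ((Real.log 2 : ℝ) : ℂ) ≠ 0 := ofReal_ne_zero.mpr (Real.log_pos (by norm_num)).ne'
  have hsC : (s : ℂ) ≠ 0 := by exact_mod_cast hs
  have ht0 : (s : ℂ) * ((Real.log 2 : ℝ) : ℂ) ≠ 0 := mul_ne_zero hsC hl0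
  have hρ0 : ρ ≠ 0 := hρ.ne_zero
  have hsρ0 : (s : ℝ) * ρ ≠ 0 := mul_ne_zero (by exact_mod_cast hs) hρ0
  -- the positive rational multiple `ρ' = ε s ρ`
  obtain ⟨ε, hε, hε1, hpos⟩ : ∃ ε : ℚ, ε ≠ 0 ∧ (ε = 1 ∨ ε = -1) ∧ 0 < (((ε * s : ℚ) : ℝ) * ρ) := by
    rcases lt_or_gt_of_ne hsρ0 with h | h
    · exact ⟨-1, by norm_num, Or.inr rfl, by push_cast; nlinarith⟩
    · exact ⟨1, one_ne_zero, Or.inl rfl, by push_cast; linarith⟩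
  have hρ' : HyperLiouville (((ε * s : ℚ) : ℝ) * ρ) := hρ.rat_mul (mul_ne_zero hε hs)
  have key : ∀ F : IntermediateField ℚ ℂ, (s : ℂ) * ((Real.log 2 : ℝ) : ℂ) ∈ F →
      (ρ : ℂ) * ((s : ℂ) * ((Real.log 2 : ℝ) : ℂ)) ∈ F →
      cexp ((ρ : ℂ) * ((s : ℂ) * ((Real.log 2 : ℝ) : ℂ))) ∈ F →
      ((((ε * s : ℚ) : ℝ) * ρ : ℝ) : ℂ) ∈ F ∧ ((Real.log 2 : ℝ) : ℂ) ∈ F ∧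
        cexp (((Real.log 2 : ℝ) : ℂ) * ((((ε * s : ℚ) : ℝ) * ρ : ℝ) : ℂ)) ∈ F := by
    intro F hz0 hz1 he1
    have hsF : (s : ℂ) ∈ F := by
      rw [← eq_ratCast (algebraMap ℚ ℂ) s]; exact F.algebraMap_mem s
    have hεF : (ε : ℂ) ∈ F := by
      rw [← eq_ratCast (algebraMap ℚ ℂ) ε]; exact F.algebraMap_mem ε
    have hl : ((Real.log 2 : ℝ) : ℂ) ∈ F := by
      have hdiv := div_mem hz0 hsF
      rwa [mul_div_cancel_left₀ _ hsC] at hdiv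
    have hρmem : (ρ : ℂ) ∈ F := by
      have hdiv := div_mem hz1 hz0
      rwa [mul_div_assoc, div_self ht0, mul_one] at hdiv
    refine ⟨?_, hl, ?_⟩
    · have e : ((((ε * s : ℚ) : ℝ) * ρ : ℝ) : ℂ) = (ε : ℂ) * (s : ℂ) * (ρ : ℂ) := by push_cast; ring
      rw [e]; exact mul_mem (mul_mem hεF hsF) hρmem
    · rcases hε1 with rfl | rfl
      · have e : cexp (((Real.log 2 : ℝ) : ℂ) * (((((1 : ℚ) * s : ℚ) : ℝ) * ρ : ℝ) : ℂ)) =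
            cexp ((ρ : ℂ) * ((s : ℂ) * ((Real.log 2 : ℝ) : ℂ))) := by
          congr 1; push_cast; ring
        rw [e]; exact he1
      · have e : cexp (((Real.log 2 : ℝ) : ℂ) * (((((-1 : ℚ) * s : ℚ) : ℝ) * ρ : ℝ) : ℂ)) =
            (cexp ((ρ : ℂ) * ((s : ℂ) * ((Real.log 2 : ℝ) : ℂ))))⁻¹ := by
          rw [← Complex.exp_neg]; congr 1; push_cast; ring
        rw [e]; exact inv_mem he1
  refine ⟨?_, ?_, ?_⟩
  · refine hyperLinLiouville_of_prefix (k := 2) (by omega) ?_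
    have h2 : (fun i : Fin 2 =>
        (![(s : ℂ) * ((Real.log 2 : ℝ) : ℂ), (ρ : ℂ) * ((s : ℂ) * ((Real.log 2 : ℝ) : ℂ)), w] :
          Fin 3 → ℂ) (Fin.castLE (show 2 ≤ 3 by omega) i)) =
        ![(s : ℂ) * ((Real.log 2 : ℝ) : ℂ), (ρ : ℂ) * ((s : ℂ) * ((Real.log 2 : ℝ) : ℂ))] := by
      funext i; fin_cases i <;> rfl
    rw [h2]; exact hyperLinLiouville_of_hyperLiouville_ratio hρ _
  · obtain ⟨h0, h1, h2⟩ := key (adjoin ℚ (SFset ![(s : ℂ) * ((Real.log 2 : ℝ) : ℂ),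
        (ρ : ℂ) * ((s : ℂ) * ((Real.log 2 : ℝ) : ℂ))] ∪ {I}))
      (mem_adjoin_SFset_I' (Or.inl ⟨0, rfl⟩)) (mem_adjoin_SFset_I' (Or.inl ⟨1, rfl⟩))
      (mem_adjoin_SFset_I' (Or.inr ⟨1, rfl⟩))
    exact sb_kummer_of_mem hNW hρ' hpos (by omega) h0 h1 h2
  · obtain ⟨h0, h1, h2⟩ := key (adjoin ℚ (SFset ![(s : ℂ) * ((Real.log 2 : ℝ) : ℂ),
        (ρ : ℂ) * ((s : ℂ) * ((Real.log 2 : ℝ) : ℂ)), w] ∪ {I}))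
      (mem_adjoin_SFset_I' (Or.inl ⟨0, rfl⟩)) (mem_adjoin_SFset_I' (Or.inl ⟨1, rfl⟩))
      (mem_adjoin_SFset_I' (Or.inr ⟨1, rfl⟩))
    exact sb_kummer_of_mem hNW hρ' hpos le_rfl h0 h1 h2

/-- Live-text form of the Kummer PAIR cell (the conclusion of A₄ʰ, 33363, at `n = 2`, anchor
`s·log 2`), mod NW 1996 Thm 1 — A₄ʰ's two hypotheses are not used. -/
theorem hyperCell_ratLog2_pair_live (hNW : NesterenkoWaldschmidt1996_thm_1) {ρ : ℝ} (hρ : HyperLiouville ρ) {s : ℚ}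
    (hs : s ≠ 0) :
    (2 : Cardinal) ≤ Algebra.trdeg ℚ ↥(IntermediateField.adjoin ℚ
      (Set.range ![(s : ℂ) * ((Real.log 2 : ℝ) : ℂ), (ρ : ℂ) * ((s : ℂ) * ((Real.log 2 : ℝ) : ℂ))] ∪
        Set.range (Complex.exp ∘
          ![(s : ℂ) * ((Real.log 2 : ℝ) : ℂ), (ρ : ℂ) * ((s : ℂ) * ((Real.log 2 : ℝ) : ℂ))]))) :=
  (hyperCell_ratLog2_any hNW hρ hs 0).2.1

/-- The instance of A₄ʰ's body (live text, `n = 3`) at the Kummer triple cells, mod NW 1996 Thm 1 —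
both hypotheses of A₄ʰ idle. -/
theorem hyperLiouvilleSchanuel_live_at_kummerCell (hNW : NesterenkoWaldschmidt1996_thm_1) {ρ : ℝ} (hρ : HyperLiouville ρ)
    {s : ℚ} (hs : s ≠ 0) (w : ℂ) :
    LinearIndependent ℚ
      ![(s : ℂ) * ((Real.log 2 : ℝ) : ℂ), (ρ : ℂ) * ((s : ℂ) * ((Real.log 2 : ℝ) : ℂ)), w] →
    (∀ m : ℕ, ∃ h : Fin 3 → ℤ, h ≠ 0 ∧
      ‖∑ i, (h i : ℂ) *
        ![(s : ℂ) * ((Real.log 2 : ℝ) : ℂ), (ρ : ℂ) * ((s : ℂ) * ((Real.log 2 : ℝ) : ℂ)), w] i‖ <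
        Real.exp (-((1 + ∑ i, (|h i| : ℝ)) ^ m))) →
    ((3 : ℕ) : Cardinal) ≤ Algebra.trdeg ℚ ↥(IntermediateField.adjoin ℚ
      (Set.range ![(s : ℂ) * ((Real.log 2 : ℝ) : ℂ), (ρ : ℂ) * ((s : ℂ) * ((Real.log 2 : ℝ) : ℂ)), w] ∪
        Set.range (Complex.exp ∘
          ![(s : ℂ) * ((Real.log 2 : ℝ) : ℂ), (ρ : ℂ) * ((s : ℂ) * ((Real.log 2 : ℝ) : ℂ)), w]))) :=
  fun _ _ => (hyperCell_ratLog2_any hNW hρ hs w).2.2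

end HyperCell

end Summit.Schanuel.Schanuel.Theorems.RootDecomp1KHyper
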